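import Mathlib
import Summits.Ventures.PercRepro2.Defs
import Summits.Ventures.PercRepro2.Graph
import Summits.Ventures.PercRepro2.OneColourSwitch
import Summits.Ventures.PercRepro2.RegionHubSign
import Summits.Ventures.PercRepro2.SideSwitch
import Summits.Ventures.PercRepro2.SideSwitchFibre
import Summits.Ventures.PercRepro2.SideSwitchComps
import Summits.Ventures.PercRepro2.M9NoPocketDefs
import Summits.Ventures.PercRepro2.M9NoPocketWorld
import Summits.Ventures.PercRepro2.M9NoPocketWorldD
import Summits.Ventures.PercRepro2.M9NoPocketCompl
import Summits.Ventures.PercRepro2.M9NoPocketFreeBlock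
import Summits.Ventures.PercRepro2.M9NoPocketFreeBlockK
import Summits.Ventures.PercRepro2.M9NoPocketSameType

/-!
# The dead patterns of a same-type representative (blind cell PercRepro2, p3 g36, 2026-08-29;
`proofs/P3-NPHDR.md` §5, the `K`-points)

For a same-type representative `ρ₀` (every edge at `d` is `Y`) and a set `D` of edges at `d`,
the dead pattern `flipF D ρ₀` has the edges of `D` `W` and the other edges at `d` `Y`
(`flipF_sameType_at_d`): a block is joined in it exactly when a live edge enters it
(`hasY_flipF_iff`), has a dead edge exactly when an edge of `D` enters it (`hasW_flipF_iff`),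
and a free block has neither.  **The `K`-points** of a dead pattern `∅ ≠ D ≠ A` — the legal
vectors in which `d` has a `Y`-source — are exactly the subsets of the free blocks
(`mem_L4_srcY_flipF_iff`): a switched joined block would be either a dead block against the
`Y`-source legality, or a `W`-source forbidding every dead edge.  For `D = A` (every edge at
`d` dead) `d` has no `Y`-source (`not_srcY_flipF_all`).  Own work; std axioms.
-/

namespace Summit.Ventures.PercRepro2

namespace NoPocket

open Finset Classical RegionHub OneColourSwitch SideSwitch

variable {V : Type*} {E : Type*}

section DeadPattern

variable [Fintype V] [DecidableEq V] [Fintype E] [DecidableEq E] {ends : E → Sym2 V}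

omit [Fintype V] [DecidableEq V] [Fintype E] in
/-- A dead pattern of a same-type representative: the edges of `D` at `d` are `W`, the other
edges at `d` are `Y`. -/
lemma flipF_sameType_at_d {d : V} {ρ₀ : Config E} (hst : ∀ e, d ∈ ends e → ρ₀ e = true)
    (D : Finset E) {e : E} (he : d ∈ ends e) :
    flipF D ρ₀ e = (if e ∈ D then false else true) := by
  by_cases heD : e ∈ D
  · rw [flipF_of_mem heD, hst e he, if_pos heD]
    rfl
  · rw [flipF_of_notMem heD, hst e he, if_neg heD]

omit [Fintype V] [DecidableEq V] [Fintype E] in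
/-- A block is joined in a dead pattern exactly when a live edge (not in `D`) enters it. -/
lemma hasY_flipF_iff {d : V} {ρ₀ : Config E} (hst : ∀ e, d ∈ ends e → ρ₀ e = true)
    (D : Finset E) (C : Finset V) :
    hasY ends d (flipF D ρ₀) C ↔ ∃ e, e ∉ D ∧ ∃ y ∈ C, ends e = s(d, y) := by
  constructor
  · rintro ⟨e, y, hy, hends, he⟩
    rw [flipF_sameType_at_d hst D (by rw [hends]; exact Sym2.mem_mk_left _ _)] at he
    refine ⟨e, ?_, y, hy, hends⟩
    intro heD
    rw [if_pos heD] at he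
    exact Bool.noConfusion he
  · rintro ⟨e, heD, y, hy, hends⟩
    refine ⟨e, y, hy, hends, ?_⟩
    rw [flipF_sameType_at_d hst D (by rw [hends]; exact Sym2.mem_mk_left _ _), if_neg heD]

omit [Fintype V] [DecidableEq V] [Fintype E] in
/-- A block has a dead edge in a dead pattern exactly when an edge of `D` enters it. -/
lemma hasW_flipF_iff {d : V} {ρ₀ : Config E} (hst : ∀ e, d ∈ ends e → ρ₀ e = true)
    (D : Finset E) (C : Finset V) :
    hasW ends d (flipF D ρ₀) C ↔ ∃ e ∈ D, ∃ y ∈ C, ends e = s(d, y) := by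
  constructor
  · rintro ⟨e, y, hy, hends, he⟩
    rw [flipF_sameType_at_d hst D (by rw [hends]; exact Sym2.mem_mk_left _ _)] at he
    refine ⟨e, ?_, y, hy, hends⟩
    by_contra heD
    rw [if_neg heD] at he
    exact Bool.noConfusion he
  · rintro ⟨e, heD, y, hy, hends⟩
    refine ⟨e, y, hy, hends, ?_⟩
    rw [flipF_sameType_at_d hst D (by rw [hends]; exact Sym2.mem_mk_left _ _), if_pos heD]

omit [Fintype V] [DecidableEq V] [Fintype E] in
/-- A free block is not joined in any dead pattern. -/
lemma not_hasY_flipF_of_free {d : V} {ρ₀ : Config E} (hst : ∀ e, d ∈ ends e → ρ₀ e = true)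
    (D : Finset E) {C : Finset V} (hfree : Free ends d C) : ¬ hasY ends d (flipF D ρ₀) C := by
  rw [hasY_flipF_iff hst]
  rintro ⟨e, _, y, hy, hends⟩
  exact hfree e y hy hends

omit [Fintype V] [DecidableEq V] [Fintype E] in
/-- A free block has no dead edge in any dead pattern. -/
lemma not_hasW_flipF_of_free {d : V} {ρ₀ : Config E} (hst : ∀ e, d ∈ ends e → ρ₀ e = true)
    (D : Finset E) {C : Finset V} (hfree : Free ends d C) : ¬ hasW ends d (flipF D ρ₀) C := by
  rw [hasW_flipF_iff hst]
  rintro ⟨e, _, y, hy, hends⟩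
  exact hfree e y hy hends

/-- **The `K`-points of a dead pattern** `∅ ≠ D ≠ A`: the legal vectors of `flipF D ρ₀` in
which `d` has a `Y`-source are exactly the subsets of the free blocks. -/
theorem mem_L4_srcY_flipF_iff {d r s : V} (hnp : NoPocketAt ends d r s) (hr : d ≠ r)
    (hs : d ≠ s) (hT : Tset ends d r s = ∅) (hloop : ∀ e, ends e ≠ s(d, d)) {ρ₀ : Config E}
    (hst : ∀ e, d ∈ ends e → ρ₀ e = true) {D : Finset E}
    (hD : D ⊆ univ.filter (fun e => d ∈ ends e)) (hD0 : D ≠ ∅)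
    (hDA : D ≠ univ.filter (fun e => d ∈ ends e)) {x : Finset (Finset V) × Finset E} :
    (x ∈ L4 ends d r s (flipF D ρ₀) ∧ srcY ends d r s (flipF D ρ₀) x) ↔
      (x.1 ⊆ (blocks ends d r s ρ₀).filter (fun C => ¬ hasY ends d ρ₀ C) ∧ x.2 = ∅) := by
  have hDd : ∀ e ∈ D, d ∈ ends e := fun e he => (Finset.mem_filter.1 (hD he)).2
  have hb := blocks_flipF (ends := ends) (r := r) (s := s) (ρ := ρ₀) hDd
  constructor
  · rintro ⟨hx, hsrc⟩
    obtain ⟨⟨hT1, hF⟩, hLW, hLY⟩ := mem_L4.1 hx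
    rw [hT] at hF
    refine ⟨?_, Finset.subset_empty.1 hF⟩
    intro C hCx
    have hC : C ∈ blocks ends d r s ρ₀ := by rw [← hb]; exact hT1 hCx
    refine Finset.mem_filter.2 ⟨hC, ?_⟩
    rintro ⟨e, y, hy, hends, _⟩
    by_cases heD : e ∈ D
    · -- a dead edge into a switched block, against the `Y`-source legality
      exact hLY hsrc C hCx ((hasW_flipF_iff hst D C).2 ⟨e, heD, y, hy, hends⟩)
    · -- a live edge into a switched block: a `W`-source, so no dead edge anywhere
      have hsrcW : srcW ends d r s (flipF D ρ₀) x :=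
        Or.inr ⟨C, hCx, (hasY_flipF_iff hst D C).2 ⟨e, heD, y, hy, hends⟩⟩
      obtain ⟨e', he'D⟩ := Finset.nonempty_iff_ne_empty.2 hD0
      obtain ⟨C', hC', y', hy'C', hends'⟩ :=
        exists_block_of_edge_at_d hnp hr hs hT hloop ρ₀ (hDd e' he'D)
      have hW' : hasW ends d (flipF D ρ₀) C' :=
        (hasW_flipF_iff hst D C').2 ⟨e', he'D, y', hy'C', hends'⟩
      have hC'b : C' ∈ blocks ends d r s (flipF D ρ₀) := by rw [hb]; exact hC'
      by_cases hC'x : C' ∈ x.1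
      · exact hLY hsrc C' hC'x hW'
      · exact hLW hsrcW C' hC'b hC'x hW'
  · rintro ⟨hx1, hx2⟩
    have hfree : ∀ C ∈ x.1, Free ends d C := fun C hC =>
      (free_iff_not_hasY_sameType hst C).2 (Finset.mem_filter.1 (hx1 hC)).2
    have hT1 : x.1 ⊆ blocks ends d r s (flipF D ρ₀) := by
      rw [hb]
      exact hx1.trans (Finset.filter_subset _ _)
    refine ⟨?_, ?_⟩
    · rw [mem_L4]
      refine ⟨⟨hT1, by rw [hx2]; exact Finset.empty_subset _⟩, ?_, ?_⟩
      · intro hsrcW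
        exfalso
        rcases hsrcW with ⟨e, he, _⟩ | ⟨C, hCx, hY⟩
        · rw [hx2] at he
          exact Finset.notMem_empty e he
        · exact not_hasY_flipF_of_free hst D (hfree C hCx) hY
      · intro _ C hCx
        exact not_hasW_flipF_of_free hst D (hfree C hCx)
    · -- a live edge exists (`D ≠ A`) and enters a joined block, which is unswitched
      obtain ⟨e, he, heD⟩ := Finset.exists_of_ssubset (Finset.ssubset_iff_subset_ne.2 ⟨hD, hDA⟩)
      have hed : d ∈ ends e := (Finset.mem_filter.1 he).2
      obtain ⟨C, hC, y, hyC, hends⟩ := exists_block_of_edge_at_d hnp hr hs hT hloop ρ₀ hed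
      have hCb : C ∈ blocks ends d r s (flipF D ρ₀) := by rw [hb]; exact hC
      refine Or.inr ⟨C, hCb, ?_, (hasY_flipF_iff hst D C).2 ⟨e, heD, y, hyC, hends⟩⟩
      intro hCx
      exact hfree C hCx e y hyC hends

/-- When every edge at `d` is dead, `d` has no `Y`-source. -/
lemma not_srcY_flipF_all {d r s : V} (hT : Tset ends d r s = ∅) {ρ₀ : Config E}
    (hst : ∀ e, d ∈ ends e → ρ₀ e = true) (x : Finset (Finset V) × Finset E) :
    ¬ srcY ends d r s (flipF (univ.filter (fun e => d ∈ ends e)) ρ₀) x := by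
  rintro (⟨e, he, _⟩ | ⟨C, _, _, hY⟩)
  · rw [hT] at he
    exact Finset.notMem_empty e he
  · obtain ⟨e, heD, y, _, hends⟩ := (hasY_flipF_iff hst _ C).1 hY
    exact heD (Finset.mem_filter.2 ⟨Finset.mem_univ _, by rw [hends]; exact Sym2.mem_mk_left _ _⟩)

end DeadPattern

end NoPocket

end Summit.Ventures.PercRepro2
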